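import Mathlib.Analysis.SpecialFunctions.Trigonometric.Bounds
import Mathlib.Analysis.Complex.Trigonometric
import Mathlib.Analysis.PSeries
import Mathlib.Algebra.Order.BigOperators.Ring.Finset
import Literature.Computability.QuantumComplexity.QFTQubits
import HarnessLib

/-!
# Fourier coefficients over `ℤ/p` read off a dyadic register by repetition (van Dam–Seroussi, analysis I)

Topic `Literature/Computability/Cryptography`; first analysis file towards the discharge of
`VanDamSeroussi2002_cubicGaussSumPhase_qsolvable` (`VanDamSeroussiGaussSums.lean`: van Dam–Seroussi 2002,
Thm. 1 for the cubic residue character — the phase of the cubic Gauss sum `G = Σ_x χ(x) e^{2πix/p}` is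
estimable in quantum polynomial time). The printed algorithm (§4, Algorithm 1) applies the quantum Fourier
transform *over the field* `𝔽_p` to the character state `|χ⟩` and uses `F_p|χ⟩ = (G/√p)|χ̄⟩`. Over the
tree's exact Clifford+`T` circuits there is no Fourier transform of order `p`; the route taken in the tree
replaces it by a transform of order `N = 2^κ` applied to the `L`-fold REPEATED embedding
`|x⟩ ↦ L^{-1/2} Σ_{j<L} |x + jp⟩` (the repetition device of Hales–Hallgren 2000 for Fourier sampling over
`ℤ/p` inside `ℤ/N`; Kitaev 1995, §5), the order-`N` transform itself being realised later by Kitaev's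
eigenvalue measurement of the increment. This file is the elementary Fourier analysis of that
replacement, for an arbitrary coefficient vector `φ : {0,…,p-1} → ℂ` (everything PROVED, [folklore]):

* `nearIdx N p y = round(py/N)` (ties up), `offset N p y = py/N − nearIdx` with `|offset| ≤ 1/2`;
* the repetition kernel `dirichletSum N L p y = Σ_{j<L} e(jpy/N) = Σ_{j<L} e(j·offset)` and the two bounds
  `‖S(y)‖ ≤ L`, **`‖S(y)‖ · |offset y| ≤ 1/2`** (geometric sum and Jordan's inequality);
* `charSum N p φ y = Σ_{x<p} φ(x) e(xy/N)` versus the genuine `ℤ/p` coefficient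
  `zpFourier p φ k = Σ_{x<p} φ(x) e(xk/p)` at `k = nearIdx`: **`‖charSum − zpFourier‖ ≤ 2π|offset| Σ‖φ‖`**;
* the unnormalised amplitude of the repeated state after the order-`N` transform,
  `repFourier N L p φ y = Σ_{x<p} Σ_{j<L} φ(x) e((x+jp)y/N) = S(y) · charSum(y)`;
* **Parseval for the reference vector** `Σ_{y<N} ‖S(y)‖² = L·N` (`Lp ≤ N`), and the resulting
  **inner-product estimate** `norm_inner_sub_main_le`: for weights `‖d‖ ≤ 1` depending on `y` only through
  `nearIdx`, `|Σ_y conj(S y) d(k_y) repFourier φ y − Σ_y ‖S y‖² d(k_y) φ̂(k_y)| ≤ π N √L Σ‖φ‖`.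

The cubic specialisation (`φ = χ`, `φ̂(k) = χ̄(k) G`, and the lower bound on the weight off `k ≡ 0`)
is the sequel `VanDamSeroussiCubicFourier.lean`. Normalisations (`(LN)^{-1/2}`) are left to the circuit files.

## References

* W. van Dam, G. Seroussi, *Efficient quantum algorithms for estimating Gauss sums*, arXiv:quant-ph/0207131
  (2002), §4 Algorithm 1 and Thm. 1 [VanDamSeroussi2002].
* L. Hales, S. Hallgren, *An improved quantum Fourier transform algorithm and applications*, FOCS 2000
  (Fourier sampling over `ℤ/p` from a power-of-two transform of repeated inputs) [HalesHallgren2000].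
* A. Yu. Kitaev, *Quantum measurements and the Abelian stabilizer problem*, arXiv:quant-ph/9511026 (1995),
  §5 [Kitaev1995].
-/

noncomputable section

namespace Literature.Computability.Cryptography

namespace VanDamSeroussi

open Finset Complex
open Literature.Computability.QuantumComplexity.QFTQubits

variable (N L p : ℕ)

/-! ### The nearest `ℤ/p` frequency and the offset -/

/-- `nearIdx N p y = round(p·y/N)` (ties rounded up): the `ℤ/p`-frequency `k ∈ {0, …, p}` whose
dyadic position `kN/p` is nearest to `y`. [folklore] -/
def nearIdx (y : ℕ) : ℕ := (2 * p * y + N) / (2 * N)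

/-- `offset N p y = p·y/N − nearIdx N p y ∈ [-1/2, 1/2)`. [folklore] -/
def offset (y : ℕ) : ℝ := (p : ℝ) * y / N - nearIdx N p y

variable {N} in
/-- The offset lies in `[-1/2, 1/2)`. [folklore] -/
theorem offset_bounds (hN : 0 < N) (y : ℕ) :
    -(1 / 2 : ℝ) ≤ offset N p y ∧ offset N p y < 1 / 2 := by
  have h2N : 0 < 2 * N := by omega
  have hdm := Nat.div_add_mod (2 * p * y + N) (2 * N)
  have hlt := Nat.mod_lt (2 * p * y + N) h2N
  set k := (2 * p * y + N) / (2 * N) with hk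
  set m := (2 * p * y + N) % (2 * N) with hm
  have hNr : (0 : ℝ) < N := by exact_mod_cast hN
  have hcast : (2 * N : ℝ) * k + m = 2 * p * y + N := by exact_mod_cast hdm
  have hmlt : (m : ℝ) < 2 * N := by exact_mod_cast hlt
  have hm0 : (0 : ℝ) ≤ m := by positivity
  have hoff : offset N p y = ((m : ℝ) - N) / (2 * N) := by
    unfold offset
    rw [show (nearIdx N p y : ℝ) = k from rfl]
    field_simp
    linarith
  rw [hoff]
  constructor
  · rw [le_div_iff₀ (by positivity)]; linarith
  · rw [div_lt_iff₀ (by positivity)]; linarith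

variable {N} in
/-- `|offset| ≤ 1/2`. [folklore] -/
theorem abs_offset_le (hN : 0 < N) (y : ℕ) : |offset N p y| ≤ 1 / 2 := by
  obtain ⟨h1, h2⟩ := offset_bounds p hN y
  exact abs_le.2 ⟨h1, h2.le⟩

variable {N p} in
/-- `p y / N = nearIdx + offset`. [folklore] -/
theorem div_eq_nearIdx_add_offset (y : ℕ) :
    (p : ℝ) * y / N = nearIdx N p y + offset N p y := by
  unfold offset; ring

/-! ### The phase `e` : two elementary estimates -/

/-- `‖e(θ) − 1‖ = 2|sin(πθ)|`. [folklore] -/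
theorem norm_eR_sub_one (θ : ℝ) : ‖eR θ - 1‖ = 2 * |Real.sin (Real.pi * θ)| := by
  have h : eR θ = Complex.exp (Complex.I * ((2 * Real.pi * θ : ℝ) : ℂ)) := by
    unfold eR; congr 1; push_cast; ring
  rw [h, Complex.norm_exp_I_mul_ofReal_sub_one, Real.norm_eq_abs, abs_mul, abs_two]
  congr 2; ring

/-- `‖e(θ) − 1‖ ≤ 2π|θ|`. [folklore] -/
theorem norm_eR_sub_one_le (θ : ℝ) : ‖eR θ - 1‖ ≤ 2 * Real.pi * |θ| := by
  have h : eR θ = Complex.exp (Complex.I * ((2 * Real.pi * θ : ℝ) : ℂ)) := by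
    unfold eR; congr 1; push_cast; ring
  rw [h]
  refine (Real.norm_exp_I_mul_ofReal_sub_one_le).trans (le_of_eq ?_)
  rw [Real.norm_eq_abs, abs_mul, abs_mul, abs_two, abs_of_pos Real.pi_pos]

/-- Jordan's inequality for `e`: `4|θ| ≤ ‖e(θ) − 1‖` when `|θ| ≤ 1/2`. [folklore] -/
theorem four_mul_abs_le_norm_eR_sub_one {θ : ℝ} (hθ : |θ| ≤ 1 / 2) : 4 * |θ| ≤ ‖eR θ - 1‖ := by
  rw [norm_eR_sub_one]
  have habs : |Real.sin (Real.pi * θ)| = Real.sin (Real.pi * |θ|) := by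
    rcases le_or_gt 0 θ with h | h
    · rw [abs_of_nonneg h]
      exact abs_of_nonneg (Real.sin_nonneg_of_nonneg_of_le_pi (by positivity)
        (by nlinarith [Real.pi_pos, abs_of_nonneg h]))
    · have hθ' : -θ ≤ 1 / 2 := by rw [abs_of_neg h] at hθ; exact hθ
      rw [abs_of_neg h]
      have hs : Real.sin (Real.pi * θ) = -Real.sin (Real.pi * (-θ)) := by
        rw [mul_neg, Real.sin_neg, neg_neg]
      rw [hs, abs_neg]
      exact abs_of_nonneg (Real.sin_nonneg_of_nonneg_of_le_pi (by nlinarith [Real.pi_pos])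
        (by nlinarith [Real.pi_pos]))
  rw [habs]
  have hj := Real.mul_le_sin (x := Real.pi * |θ|) (by positivity) (by nlinarith [Real.pi_pos, abs_nonneg θ])
  have : 2 / Real.pi * (Real.pi * |θ|) = 2 * |θ| := by field_simp
  rw [this] at hj
  linarith

/-- `e(nθ) = e(θ)^n`. [folklore] -/
theorem eR_nat_mul (n : ℕ) (θ : ℝ) : eR (n * θ) = eR θ ^ n := by
  unfold eR
  rw [← Complex.exp_nat_mul]; congr 1; push_cast; ring

/-- `e(θ) = 1` forces `θ ∈ ℤ`. [folklore] -/
theorem exists_int_of_eR_eq_one {θ : ℝ} (h : eR θ = 1) : ∃ n : ℤ, θ = n := by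
  unfold eR at h
  obtain ⟨n, hn⟩ := Complex.exp_eq_one_iff.1 h
  refine ⟨n, ?_⟩
  have hI : (2 * Real.pi * Complex.I : ℂ) ≠ 0 := by simp [Real.pi_ne_zero, Complex.I_ne_zero]
  have h' : ((θ : ℂ) - n) * (2 * Real.pi * Complex.I) = 0 := by
    rw [sub_mul, ← hn]; ring
  rcases mul_eq_zero.1 h' with h0 | h0
  · exact_mod_cast sub_eq_zero.1 h0
  · exact absurd h0 hI

/-! ### The repetition kernel `S(y) = Σ_{j<L} e(jpy/N)` -/

/-- The repetition (Dirichlet) kernel `S(y) = Σ_{j<L} e(jpy/N)`: the unnormalised order-`N` Fourier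
amplitude at `y` of the repeated basis vector `L^{-1/2} Σ_{j<L} |jp⟩`. [folklore] -/
def dirichletSum (y : ℕ) : ℂ := ∑ j ∈ range L, eR ((j : ℝ) * p * y / N)

variable {N} in
/-- `S(y) = Σ_{j<L} e(j · offset y)`: the integer part `j · nearIdx` of the phase drops out. [folklore] -/
theorem dirichletSum_eq_sum_offset (y : ℕ) :
    dirichletSum N L p y = ∑ j ∈ range L, eR (j * offset N p y) := by
  unfold dirichletSum
  refine sum_congr rfl fun j _ => eR_eq_of_sub_eq_intCast (n := ((j * nearIdx N p y : ℕ) : ℤ)) ?_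
  have := div_eq_nearIdx_add_offset (N := N) (p := p) y
  push_cast
  calc (j : ℝ) * p * y / N - j * offset N p y = j * ((p : ℝ) * y / N - offset N p y) := by ring
    _ = j * (nearIdx N p y : ℝ) := by rw [this]; ring

/-- `‖S(y)‖ ≤ L`. [folklore] -/
theorem norm_dirichletSum_le (y : ℕ) : ‖dirichletSum N L p y‖ ≤ L := by
  unfold dirichletSum
  refine (norm_sum_le _ _).trans ?_
  simp [norm_eR]

variable {N} in
/-- **The kernel decays off the grid**: `‖S(y)‖ · |offset y| ≤ 1/2` (geometric sum: `S·(e(δ)−1) =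
e(Lδ)−1`, so `‖S‖·4|δ| ≤ ‖S‖·‖e(δ)−1‖ ≤ 2`). [folklore] -/
theorem norm_dirichletSum_mul_abs_offset_le (hN : 0 < N) (y : ℕ) :
    ‖dirichletSum N L p y‖ * |offset N p y| ≤ 1 / 2 := by
  set δ := offset N p y with hδ
  have hδle : |δ| ≤ 1 / 2 := abs_offset_le p hN y
  have hS : dirichletSum N L p y = ∑ j ∈ range L, eR δ ^ j := by
    rw [dirichletSum_eq_sum_offset]
    exact sum_congr rfl fun j _ => eR_nat_mul j δ
  have hgeom : dirichletSum N L p y * (eR δ - 1) = eR δ ^ L - 1 := by rw [hS]; exact geom_sum_mul _ _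
  have h2 : ‖dirichletSum N L p y‖ * ‖eR δ - 1‖ ≤ 2 := by
    rw [← norm_mul, hgeom]
    refine (norm_sub_le _ _).trans ?_
    rw [norm_pow, norm_eR, one_pow, norm_one]; norm_num
  have h4 := four_mul_abs_le_norm_eR_sub_one hδle
  have hSn : 0 ≤ ‖dirichletSum N L p y‖ := norm_nonneg _
  nlinarith [mul_le_mul_of_nonneg_left h4 hSn]

/-! ### Fourier coefficients: order `N` versus order `p` -/

/-- `charSum N p φ y = Σ_{x<p} φ(x) e(xy/N)`: the order-`N` Fourier sum of the coefficient vector `φ`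
placed on `{0, …, p-1}`. [folklore] -/
def charSum (φ : ℕ → ℂ) (y : ℕ) : ℂ := ∑ x ∈ range p, φ x * eR ((x : ℝ) * y / N)

/-- `zpFourier p φ k = φ̂(k) = Σ_{x<p} φ(x) e(xk/p)`: the genuine (unnormalised) Fourier coefficient over
`ℤ/p`. [folklore] -/
def zpFourier (φ : ℕ → ℂ) (k : ℕ) : ℂ := ∑ x ∈ range p, φ x * eR ((x : ℝ) * k / p)

variable {N p} in
/-- **The order-`N` sum is the `ℤ/p` coefficient at the nearest frequency, up to `2π|offset| Σ‖φ‖`**: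
`e(xy/N) = e(xk/p) e(x·offset/p)` and `‖e(x·offset/p) − 1‖ ≤ 2π|offset|` for `x < p`. [folklore] -/
theorem norm_charSum_sub_zpFourier_le (hp : 0 < p) (φ : ℕ → ℂ) (y : ℕ) :
    ‖charSum N p φ y - zpFourier p φ (nearIdx N p y)‖ ≤
      2 * Real.pi * |offset N p y| * ∑ x ∈ range p, ‖φ x‖ := by
  set δ := offset N p y with hδ
  set k := nearIdx N p y with hk
  have hpr : (0 : ℝ) < p := by exact_mod_cast hp
  have hsplit : ∀ x : ℕ, eR ((x : ℝ) * y / N) = eR ((x : ℝ) * k / p) * eR ((x : ℝ) * δ / p) := by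
    intro x
    rw [← eR_add]; congr 1
    have := div_eq_nearIdx_add_offset (N := N) (p := p) y
    rw [← hk, ← hδ] at this
    calc (x : ℝ) * y / N = x * ((p : ℝ) * y / N) / p := by field_simp
      _ = _ := by rw [this]; ring
  unfold charSum zpFourier
  rw [← sum_sub_distrib, mul_sum]
  refine (norm_sum_le _ _).trans (sum_le_sum fun x hx => ?_)
  rw [hsplit x, ← mul_assoc, ← mul_sub_one, norm_mul, norm_mul, norm_eR, mul_one]
  have hx : (x : ℝ) < p := by exact_mod_cast mem_range.1 hx
  have h1 : ‖eR ((x : ℝ) * δ / p) - 1‖ ≤ 2 * Real.pi * |δ| := by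
    refine (norm_eR_sub_one_le _).trans ?_
    rw [abs_div, abs_mul, abs_of_nonneg (Nat.cast_nonneg x), abs_of_pos hpr]
    have : (x : ℝ) * |δ| / p ≤ |δ| := by
      rw [div_le_iff₀ hpr]; nlinarith [abs_nonneg δ]
    nlinarith [Real.pi_pos]
  calc ‖φ x‖ * ‖eR ((x : ℝ) * δ / p) - 1‖ ≤ ‖φ x‖ * (2 * Real.pi * |δ|) :=
        mul_le_mul_of_nonneg_left h1 (norm_nonneg _)
    _ = 2 * Real.pi * |δ| * ‖φ x‖ := by ring

/-- `repFourier N L p φ y = Σ_{x<p} Σ_{j<L} φ(x) e((x + jp) y/N)`: `√(LN)` times the order-`N` Fourier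
amplitude at `y` of the repeated state `L^{-1/2} Σ_x Σ_{j<L} φ(x) |x + jp⟩`. [folklore] -/
def repFourier (φ : ℕ → ℂ) (y : ℕ) : ℂ :=
  ∑ x ∈ range p, ∑ j ∈ range L, φ x * eR (((x : ℝ) + j * p) * y / N)

/-- **Factorisation** `repFourier = S · charSum`. [folklore] -/
theorem repFourier_eq (φ : ℕ → ℂ) (y : ℕ) :
    repFourier N L p φ y = dirichletSum N L p y * charSum N p φ y := by
  unfold repFourier dirichletSum charSum
  rw [sum_mul_sum]
  refine sum_comm.trans (sum_congr rfl fun j _ => sum_congr rfl fun x _ => ?_)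
  rw [show ((x : ℝ) + j * p) * y / N = (j : ℝ) * p * y / N + (x : ℝ) * y / N by ring, eR_add]
  ring

/-! ### Parseval for the reference kernel -/

variable {N} in
/-- Orthogonality of the order-`N` phases: `Σ_{y<N} e(my/N) = N·[N ∣ m]`. [folklore] -/
theorem sum_eR_int_mul_div (hN : 0 < N) (m : ℤ) :
    ∑ y ∈ range N, eR ((m : ℝ) * y / N) = if (N : ℤ) ∣ m then (N : ℂ) else 0 := by
  have hNr : (N : ℝ) ≠ 0 := by exact_mod_cast hN.ne'
  have hpow : ∀ y : ℕ, eR ((m : ℝ) * y / N) = eR ((m : ℝ) / N) ^ y := fun y => by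
    rw [← eR_nat_mul]; congr 1; ring
  simp_rw [hpow]
  split_ifs with hdvd
  · obtain ⟨c, rfl⟩ := hdvd
    rw [show ((N * c : ℤ) : ℝ) / N = (c : ℝ) by push_cast; field_simp, eR_intCast]
    simp
  · have hne : eR ((m : ℝ) / N) ≠ 1 := by
      intro h
      obtain ⟨n, hn⟩ := exists_int_of_eR_eq_one h
      refine hdvd ⟨n, ?_⟩
      have : (m : ℝ) = N * n := by field_simp at hn; linarith
      exact_mod_cast this
    rw [geom_sum_eq hne, ← eR_nat_mul, show (N : ℝ) * ((m : ℝ) / N) = (m : ℝ) by field_simp,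
      eR_intCast, sub_self, zero_div]

variable {N L p} in
/-- **Parseval for the repeated reference vector**: `Σ_{y<N} ‖S(y)‖² = L·N` when `Lp ≤ N` and `p ≥ 1`
(distinct repetitions `jp ≠ j'p` stay distinct modulo `N`). [folklore] -/
theorem sum_norm_sq_dirichletSum (hN : 0 < N) (hp : 0 < p) (hLN : L * p ≤ N) :
    ∑ y ∈ range N, ‖dirichletSum N L p y‖ ^ 2 = L * N := by
  -- work in `ℂ`
  suffices h : (∑ y ∈ range N, (‖dirichletSum N L p y‖ ^ 2 : ℂ)) = L * N by exact_mod_cast h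
  have hconj : ∀ θ : ℝ, (starRingEnd ℂ) (eR θ) = eR (-θ) := fun θ => by
    unfold eR; rw [← Complex.exp_conj]; congr 1
    simp only [map_mul, map_ofNat, Complex.conj_ofReal, Complex.conj_I]
    push_cast; ring
  calc (∑ y ∈ range N, (‖dirichletSum N L p y‖ ^ 2 : ℂ))
      = ∑ y ∈ range N, ∑ j ∈ range L, ∑ j' ∈ range L,
          eR ((((j : ℤ) - j' : ℤ) : ℝ) * p * y / N) := by
        refine sum_congr rfl fun y _ => ?_
        rw [← Complex.ofReal_pow, Complex.sq_norm, ← Complex.mul_conj, dirichletSum, map_sum, sum_mul_sum]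
        refine sum_congr rfl fun j _ => sum_congr rfl fun j' _ => ?_
        rw [hconj, ← eR_add]; congr 1; push_cast; ring
    _ = ∑ j ∈ range L, ∑ j' ∈ range L, ∑ y ∈ range N,
          eR ((((((j : ℤ) - j') * p : ℤ)) : ℝ) * y / N) := by
        rw [sum_comm]; refine sum_congr rfl fun j _ => ?_
        rw [sum_comm]; refine sum_congr rfl fun j' _ => sum_congr rfl fun y _ => ?_
        congr 1; push_cast; ring
    _ = ∑ j ∈ range L, ∑ j' ∈ range L, (if j = j' then (N : ℂ) else 0) := by
        refine sum_congr rfl fun j hj => sum_congr rfl fun j' hj' => ?_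
        rw [sum_eR_int_mul_div hN]
        have hj := mem_range.1 hj; have hj' := mem_range.1 hj'
        by_cases hjj : j = j'
        · subst hjj; simp
        · rw [if_neg hjj, if_neg]
          rintro ⟨c, hc⟩
          -- `|j - j'| p < L p ≤ N`, so `N ∣ (j-j')p` forces `j = j'`
          have habs : |((j : ℤ) - j') * p| < N := by
            rw [abs_mul, abs_of_nonneg (by positivity : (0 : ℤ) ≤ p)]
            have : |(j : ℤ) - j'| < L := by rw [abs_lt]; constructor <;> omega
            calc |(j : ℤ) - j'| * p < L * p := by
                  exact Int.mul_lt_mul_of_pos_right this (by exact_mod_cast hp)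
              _ ≤ N := by exact_mod_cast hLN
          rw [hc, abs_mul, abs_of_nonneg (by positivity : (0 : ℤ) ≤ N)] at habs
          have hc0 : c ≠ 0 := by
            rintro rfl
            rw [mul_zero] at hc
            rcases mul_eq_zero.1 hc with h | h
            · exact hjj (by omega)
            · omega
          have : (1 : ℤ) ≤ |c| := Int.one_le_abs hc0
          nlinarith
    _ = ∑ j ∈ range L, (N : ℂ) := by
        refine sum_congr rfl fun j hj => ?_
        rw [sum_ite_eq]; exact if_pos hj
    _ = L * N := by simp

/-! ### The inner-product estimate -/

variable {N L p} in
/-- **Inner-product estimate.** For weights `d` of modulus `≤ 1` read through the nearest frequency,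
`|Σ_y conj(S y) · d(k_y) · repFourier φ y − Σ_y ‖S y‖² · d(k_y) · φ̂(k_y)| ≤ π · N · √L · Σ_x ‖φ x‖`
(termwise `‖S‖·2π|δ|·Σ‖φ‖ ≤ π Σ‖φ‖` by the kernel decay, then Cauchy–Schwarz against `Σ‖S‖² = LN`).
[folklore] -/
theorem norm_inner_sub_main_le (hN : 0 < N) (hp : 0 < p) (hLN : L * p ≤ N)
    (d : ℕ → ℂ) (hd : ∀ k, ‖d k‖ ≤ 1) (φ : ℕ → ℂ) :
    ‖(∑ y ∈ range N, (starRingEnd ℂ) (dirichletSum N L p y) * d (nearIdx N p y) * repFourier N L p φ y) -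
        ∑ y ∈ range N, (‖dirichletSum N L p y‖ ^ 2 : ℂ) * d (nearIdx N p y) *
          zpFourier p φ (nearIdx N p y)‖ ≤
      Real.pi * N * Real.sqrt L * ∑ x ∈ range p, ‖φ x‖ := by
  set M := ∑ x ∈ range p, ‖φ x‖ with hM
  have hM0 : 0 ≤ M := sum_nonneg fun _ _ => norm_nonneg _
  set S := dirichletSum N L p with hS
  -- the difference, termwise
  have hdiff : (∑ y ∈ range N, (starRingEnd ℂ) (S y) * d (nearIdx N p y) * repFourier N L p φ y) -
      ∑ y ∈ range N, (‖S y‖ ^ 2 : ℂ) * d (nearIdx N p y) * zpFourier p φ (nearIdx N p y) =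
      ∑ y ∈ range N, (starRingEnd ℂ) (S y) * (d (nearIdx N p y) * S y *
        (charSum N p φ y - zpFourier p φ (nearIdx N p y))) := by
    rw [← sum_sub_distrib]
    refine sum_congr rfl fun y _ => ?_
    rw [repFourier_eq, ← Complex.ofReal_pow, Complex.sq_norm, ← Complex.mul_conj]
    ring
  rw [hdiff]
  -- termwise bound `‖b_y‖ ≤ π M`
  have hterm : ∀ y, ‖d (nearIdx N p y) * S y * (charSum N p φ y - zpFourier p φ (nearIdx N p y))‖ ≤
      Real.pi * M := by
    intro y
    rw [norm_mul, norm_mul]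
    have h1 := norm_charSum_sub_zpFourier_le (N := N) hp φ y
    have h2 := norm_dirichletSum_mul_abs_offset_le L p hN y
    calc ‖d (nearIdx N p y)‖ * ‖S y‖ * ‖charSum N p φ y - zpFourier p φ (nearIdx N p y)‖
        ≤ 1 * ‖S y‖ * (2 * Real.pi * |offset N p y| * M) := by
          gcongr
          exact hd _
      _ = 2 * Real.pi * M * (‖S y‖ * |offset N p y|) := by ring
      _ ≤ 2 * Real.pi * M * (1 / 2) := by gcongr
      _ = Real.pi * M := by ring
  -- Cauchy–Schwarz
  have hCS : (∑ y ∈ range N, ‖S y‖) ^ 2 ≤ N * (L * N) := by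
    have := sum_mul_sq_le_sq_mul_sq (range N) (fun _ => (1 : ℝ)) (fun y => ‖S y‖)
    simp only [one_mul, one_pow, sum_const, card_range, nsmul_eq_mul, mul_one] at this
    rwa [sum_norm_sq_dirichletSum hN hp hLN] at this
  have hsumS : ∑ y ∈ range N, ‖S y‖ ≤ N * Real.sqrt L := by
    have h0 : 0 ≤ ∑ y ∈ range N, ‖S y‖ := sum_nonneg fun _ _ => norm_nonneg _
    have hsq : ((N : ℝ) * Real.sqrt L) ^ 2 = N * (L * N) := by
      rw [mul_pow, Real.sq_sqrt (Nat.cast_nonneg L)]; ring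
    have hb : 0 ≤ (N : ℝ) * Real.sqrt L := by positivity
    rw [← hsq] at hCS
    exact (pow_le_pow_iff_left₀ h0 hb (by norm_num)).1 hCS
  calc ‖∑ y ∈ range N, (starRingEnd ℂ) (S y) *
          (d (nearIdx N p y) * S y * (charSum N p φ y - zpFourier p φ (nearIdx N p y)))‖
      ≤ ∑ y ∈ range N, ‖S y‖ * (Real.pi * M) := by
        refine (norm_sum_le _ _).trans (sum_le_sum fun y _ => ?_)
        rw [norm_mul, Complex.norm_conj]
        exact mul_le_mul_of_nonneg_left (hterm y) (norm_nonneg _)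
    _ = Real.pi * M * ∑ y ∈ range N, ‖S y‖ := by rw [← sum_mul]; ring
    _ ≤ Real.pi * M * (N * Real.sqrt L) := by gcongr
    _ = Real.pi * N * Real.sqrt L * M := by ring

end VanDamSeroussi

end Literature.Computability.Cryptography
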